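import Literature.NumberTheory.EllipticCurves.Kato2004.IwasawaCohomologyCoeffNewform
import Literature.NumberTheory.EllipticCurves.Kato2004.EulerSystemValues
import Literature.NumberTheory.EllipticCurves.CyclotomicLayerRhoTatePairingPk
import Literature.NumberTheory.EllipticCurves.GlobalMinimalModel
import Literature.NumberTheory.EllipticCurves.FormalGroup
import Literature.NumberTheory.EllipticCurves.FormalGroupChart
import Mathlib.NumberTheory.DirichletCharacter.GaussSum
import HarnessLib

/-!
# Kato 2004 (Astérisque 295) Thm. 12.5 (1) — the `p`-adic zeta element of a weight-`2` newform `g` WITH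
# `𝒪_λ`-COEFFICIENTS and its dual-exponential VALUES, at `p = 2`, read (Bloch–Kato 1990 §3, Rubin 1998 §5,
# Kobayashi 2003 §8) on the PINNED layer Tate pairings of the lattice `T_ρ` through a local transport
# `Θ : A_ρ ≃ E[2^∞]ⁿ` — ONE named fact (D-0014; nothing asserted), the `𝒪_λ`-coefficient, `Λ`-adic twin of
# `Kato2004.exists_eulerSystem_expStar_tatePairing_values_two`

Topic `NumberTheory/EllipticCurves`, sub-directory `Kato2004` (namespace = path). Typed by the ARM-P typist
`bsd-armP-typer-22608-Kato125` (literature lane of cells `bsd-eis`/`bsd-wall`, director-bsd (395)(5)) for the crux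
RSL_g = stmt-BirchSwinnertonDyer-22608 `ResidualSignedLambdaLowerCMAtTwo` (route `ResidualThetaTransportAtTwo`, LEAD
`bsd-wall-rtt-p2`, registered skeleton `Cruxes/ResidualSignedLambdaLowerCMAtTwo/Lines/onepair.lean` v3g): its PRINT stub
`stub_kzgChildA` (child A `KatoZetaValuedClassCMAtTwo` of the HOLD item stmt-BirchSwinnertonDyer-24105:
`∀ F : π.KatoFrame, ∃ z c' w q μt, π.KatoValuedClass g ι Ω F.Φ F.τ z c' w q μt`, file
`Summits/…/Theorems/ResidualThetaTransportAtTwoKatoZetaDefs.lean`) is «Kato 2004 Thm. 12.5 (1) for the CM θ-partner `g`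
at `p = 2` with `𝒪_λ`-coefficients, at the one-pair pins». The companion facts of `Kato2004/IwasawaCohomologyCoeffNewform.lean`
(`nonempty_iwasawaH1DataCoeff_newform`, `thm12_4_newform`) deliberately left Thm. 12.5 (1) untyped: "their VALUE clause needs
the dual exponential / `S(f)` / period vocabulary for `V_{F_λ}(g)`, absent from the tree", and a CLOSED `∃`-statement over an
abstract value datum would be trivially inhabited (`Kato2004/ZetaQuotientPackageCoeff.lean`, module docstring). THIS FILE types
it the way the tree typed the same theorem for `T₂E` (`Kato2004/EulerSystemTatePairingValuesTwo.lean`, consumed by the K3 line of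
route `ThetaPartnerAtTwo` through `KatoBK.coreKZ_of_coreKZLit`): the dual exponential never appears as an object; its values are
RATIONAL tensors `y_N ∈ K_g ⊗_ℚ ℚ(ζ_{2^N})` (Kato's rationality clause), read `2`-adically on THE pinned `ρ`-layer Tate pairing
family (`CyclotomicLayer.rhoLayerPairingPk`, a HYPOTHESIS BY NAME exactly as the consumer's pin `OnePairPins.pair/hpair`) against
formal points of `W` through `Θ` (Bloch–Kato), and complex-analytically through Kato's value law, which — being an identity of
`K_g ⊗ ℚ(ζ_{2^N})`-rational quantities — is stated in EVERY realisation `(R, s₁ : K_g → R, s₂ : ℚ(ζ_{2^N}) → R)` (READING (R4);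
`R = ℂ` with the standard embeddings is Kato's sentence, `R = ℚ̄₂` with `(ι, e_N)` is what the consumer instantiates).
HONEST FRAMING: a named fact (`def … : Prop`); nothing asserted; net debt +1; no `_holds` expected (size XL: Kato's
construction §§2–9 and the explicit reciprocity law §§10–13, §15 for CM forms); no lemma, no instance, no
notation, no `sorry`; BSD is not advanced by this file and nothing is claimed about any particular curve or form.

## The printed statements (`[p. N]` = printed page; store `paper:doi-10-24033-ast-639`, PDF page `N − 115`, pages
p0106–p0108, p0114–p0117, p0148–p0150 re-read by this seat 2026-08-29; OCR of displays is lossy — prose verbatim, displays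
reconstructed and cross-checked against the tree's earlier image reads in `EulerSystemValues.lean` / `EulerSystemTatePairingValuesTwo.lean`)

* **§12.3, Thm. 12.5 (1)** [pp. 221–222] "Let `k, N` and `f = Σ aₙqⁿ` be as in the beginning of Chap. III, and let
  `F = ℚ(aₙ ; n ≥ 1)` … `λ` a place of `F` lying over `p` … `Λ = O_λ[[G_∞]]`. … **Theorem 12.5** (1) There exists a unique
  `F_λ`-linear map `V_{F_λ}(f) → 𝐇¹(V_{F_λ}(f)); γ ↦ z_γ^{(p)}` having the following property: Let `r ∈ ℤ`, `1 ≤ r ≤ k − 1`,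
  let `n ≥ 0` [sic; OCR], and let `γ ∈ V_F(f)`. Then the image of `z_γ^{(p)}` under the composite map
  `𝐇¹(V_{F_λ}(f)) ≅ 𝐇¹(V_{F_λ}(f)(k − r)) → H¹(ℚ(ζ_{pⁿ}) ⊗ ℚ_p, V_{F_λ}(f)(k − r)) →exp*→ S(f) ⊗_F F_λ ⊗_ℚ ℚ(ζ_{pⁿ})`
  (the first isomorphism is the product with `((ζ_{pⁿ})_{n≥1})^{⊗(k−r)}`) belongs to `S(f) ⊗_ℚ ℚ(ζ_{pⁿ})`, and the map
  `S(f) ⊗_ℚ ℚ(ζ_{pⁿ}) → V_ℂ(f)^±; x ⊗ y ↦ Σ_{σ ∈ G_n} χ(σ)σ(y) per_f(x)^±`, where `χ` is any character `G_n → ℂ^×` and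
  `± = (−1)^{k−r−1}χ(−1)`, sends the image of `z_γ^{(p)}` to `(2πi)^{k−r−1} · L_{{p}}(f*, χ, r) · γ^±`. We have
  `z^{(p)}_{ι(γ)} = −σ_{−1}(z^{(p)}_γ)` for all `γ ∈ V_{F_λ}(f)`, where `ι` is the action of the complex conjugation."
  With §6.2 [p. 161] "`L_S(f, χ, s) = Σ_{(n,S)=1} aₙ χ(n) n^{−s}`", §6.5 "`f* = Σ āₙqⁿ`" [p. 163], the period map `per_f` and
  the pairing (7.13) [pp. 168–169], and `G_n = Gal(ℚ(ζ_{pⁿ})/ℚ) ∋ σ_b ↔ b` (`σ_b ζ = ζ^b`, Prop. 5.3 / (5.7.1) [pp. 155, 157]).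
* **Proofs.** [p. 223] "The proofs of Thm. 12.4, 12.5, 12.6 are given in §13 in the case `f` has no CM and in §15 in the case
  `f` has CM. The proof in the case `f` has CM heavily depends on the work of Rubin [Ru1]." §13.9 [p. 229] "we define the
  `p`-adic zeta element `z_γ^{(p)}` for `γ ∈ V_{F_λ}(f)` … first as an element of `𝐇¹(V_{F_λ}(f)) ⊗_Λ Q(Λ). We will see in
  13.12 that `z_γ^{(p)}` belongs to `𝐇¹(V_{F_λ}(f))`"; §13.12 [pp. 231–232] "we prove Thm. 12.5 (1) and Thm. 12.6";
  §15.16 [p. 265] "We prove Thm. 12.5 and Thm. 12.6 for `f` in the case `K` is not contained in `ℚ(ζ_{p^∞})`. Since we have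
  already proved Thm. 12.4 for `f` [15.15, both cases `K ⊄ ℚ(ζ_{p^∞})` and `K ⊂ ℚ(ζ_{p^∞})`], Thm. 12.5 (1)(2) and Thm. 12.6
  are proved by the same arguments in 13.9–13.13." NO hypothesis on `p` (`p = 2`, `p ∣ N` allowed) and no image hypothesis
  enters (1); those enter (4) only ("Assume `p ≠ 2`", (12.5.2)).
* **Thm. 12.4 (2)** [p. 221] "`𝐇¹(T)` is a torsion free `Λ`-module, and `𝐇¹(T) ⊗ ℚ = 𝐇¹(V_{F_λ}(f))`" (so `z_γ^{(p)} = z̃ ⊗ p^{−s}`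
  with `z̃ ∈ 𝐇¹(T) = lim←_n H¹(ℤ[ζ_{pⁿ}, 1/p], T)`); **§14.10 (14.10.1), (14.10.3)** [pp. 240–241] (a lattice with arithmetic
  Frobenius polynomials `X² − a_ℓX + ℓ` sits in `V_{F_λ}(f)(1)`, `k = 2`, trivial character — READING (R1) of
  `IwasawaCohomologyCoeffNewform.lean`, repeated below).
* **Bloch–Kato 1990** [BlochKato1990] Def. 3.10 / Ex. 3.10.1 [pp. 359–360] ("the exponential map (3.10) coincides with the
  classical one" for a formal Lie group), Ex. 3.11 [p. 361] (abelian varieties: the Kummer map is `exp ∘ log`); **Kato LNM 1553**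
  II Thm. 1.4.1 (4) (`exp*` is the transpose of `exp` under local Tate duality); **Rubin 1998** [Rubin1998Durham] §5 (1)–(2)
  ("`z ∈ H¹_{/𝒮}(ℚ_{n,p}, V)` corresponds to the map `x ↦ Tr_{ℚ_{n,p}/ℚ_p} λ_E(x) exp*_{ω_E}(z)`"); **Kobayashi 2003**
  [Kobayashi2003] (8.23) [p. 18], (8.29)/Prop. 8.25 [p. 24] ("`(x, z)_n = Tr_{k_n/ℚ_p} log_Ê(x) exp*_{ω_E}(z)` … Here `( , )_n`
  is the Tate pairing") — all quoted at length in `EulerSystemTatePairingValuesTwo.lean` §"Why (KZ) is print".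
* **Birch's formula** (tree `ModularForms.twisted_LValue_eq`, [Birch1971], [MazurTateTeitelbaum1986Invent] §I.8 (8.6)):
  `τ(χ̄) L(g, χ, 1) = Σ_{a mod m} χ̄(a) {∞, a/m}_g` for primitive `χ mod m`, `{∞, r}_g = modularSymbol g r = 2πi∫_{i∞}^r g`,
  `τ(χ) = Σ_a χ(a)e^{2πia/m}`; `{∞, 0}_g = L(g, 1)` (`ModularForms.modularSymbol_zero_eq`, [Manin1972]); Shimura periods
  `IsPlusPeriod g Ω` (`plusSymbol g r / Ω ∈ K_g`, [PollackWeston2011MT] §2.2, [Shimura1977] Thm. 1), `[r]⁺_{g,Ω} = plusSymbolK g Ω r`.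

## What the fact says, and the READINGS by which each binder is a printed object (own attribution, each ≤ 3 lines)

DATA (universally quantified, the consumer's pins `OnePairPins` field for field with `S = Set.range ι`): a newform
`g ∈ S₂(Γ₀(M))` (`IsNewform0`), `ι : K_g → ℚ̄₂`, a Shimura period `Ω`; an integral model `ρ : Γ_ℚ → GL₂(𝒪)`,
`𝒪 = padicCoeffIntegers (Set.range ι)`, with arithmetic Frobenius polynomials `X² − ι(a_ℓ)X + ℓ` at `ℓ ∤ 2M`; the cyclotomic
`ℤ₂`-extension `κ` with topological generator `γ` and Kato's datum `I : IwasawaH1DataCoeff ρ 2 κ γ` (K0, BY NAME); a globally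
minimal elliptic curve `W/ℚ`, a place `v ∋ 2`, a transport `Θ : A_ρ ≃+ E[2^∞]ⁿ` equivariant for the decomposition group at `v`;
Frobenius datum `t₀ : 𝒪 → ℤ₂` with dual families, roots of unity `ζ_k`, and the self-dual tower `ePk` on `A_ρ[2^k]` pinned by
`t₀, ζ` (value formula `e_k(2^{−k}s, 2^{−k}t) = ζ_k^{t₀(s∧t)}`); THE `ℤ₂`-valued layer pairing family `pair` pinned by its residues
`rhoLayerPairingPk … m k` (hypothesis by name; `eq_of_forall_toZModPow_eq_rhoLayerPairingPk`: at most one such family); a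
`2`-adic frame: `Φ : ℚ̄₂ ≅ ℚ̄_v` over `φ : ℚ₂ ≅ ℚ_v`, primitive roots `ζc_k ∈ ℚ(ζ_{2^k})`, a tower `e_k : ℚ(ζ_{2^k}) → ℚ̄₂`
COHERENT along `ζc_k ↦ ζc_{k+1}²` (`e_{k+1}(ζc_{k+1})² = e_k(ζc_k)`) with Galois lifts `τ_k(a)` (`τ_k(a)·e_k(ζc_k) = e_k(ζc_k)^a`).
CONCLUSION (existential — Kato's outputs, no abstract datum): a class `z ∈ 𝐇¹_Γ(T_ρ) = I.H`,
comparison functionals `ℓ_i : ℚ̄₂ →ₗ[ℚ₂] ℚ₂` (`i < n`) separating `𝒪`, RATIONAL values `y_N = Σ_k f_{N,k} ⊗ u_{N,k}`,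
`f_{N,k} ∈ K_g`, `u_{N,k} ∈ ℚ(ζ_{2^N})`, and `r ∈ K_g^×`, such that (BK) for every `a ∈ 𝒪`, layer `m`, coordinate `i` and formal
point `Q₀` of `W` over the layer field (through `Φ`): `⟨proj_m(a·z), Q₀e_i⟩_m = Σ_k ℓ_i(a·ι f_{m+2,k}) · Σ_{b ∈ (ℤ/2^{m+2})ˣ}
τ_{m+2}(b)(log_W(z(Q₀)) · e_{m+2}(u_{m+2,k}))`; (VAL) for `N ≥ 2`, every realisation `(R, s₁, s₂)` and every EVEN PRIMITIVE
`χ mod 2^N`: `(Σ_k s₁f_{N,k} Σ_b χ̄(b) s₂(σ_b u_{N,k})) · τ_{s₂}(χ) = s₁(r) Σ_a χ(a) s₁[a/2^N]⁺_{g,Ω}`, `τ_{s₂}(χ) = Σ_a χ(a)s₂(ζc_N)^a`,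
`σ_b = EulerSystemValues.sigma (2^N) b` (`σ_b ζ = ζ^b`); (TRIV) for `N ≥ 2`:
`2 Σ_k s₁f_{N,k} s₂(Tr u_{N,k}) = s₁(r)(2 − s₁a₂(g) + ε_M(2)) s₁[0]⁺_{g,Ω}`, `ε_M(2) = 0` if `2 ∣ M` else `1`.

(R1) LATTICE AND TWIST. `T_ρ` is a `Gal(ℚ̄/ℚ)`-stable `O_λ`-lattice of `V_{F_λ}(g)(1)` (arithmetic Frobenius polynomial
`X² − a_ℓX + ℓ` = (14.10.3) on the dual = `V(g)(1)` by (14.10.1), `k = 2`, `g* = g`; Chebotarev + Brauer–Nesbitt), the position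
reached by "the first isomorphism" of 12.5 (1) with `k − r = 1`; the theorem is applied with `r = 1` (`(2πi)^{k−r−1} = 1`,
`± = χ(−1)`), `f* = g` (trivial character: real Fourier coefficients).
(R2) INTEGRALITY AND LAYERS. `z_γ^{(p)} = z̃ ⊗ 2^{−s}` with `z̃ ∈ 𝐇¹(T_ρ)` (12.4 (2), 13.12); `z := ` the `Λ`-adic lift
(`IwasawaH1DataCoeff.lift`) of the norm-compatible family `(Cor_{ℚ(ζ_{2^{m+2}})/ℚ_m} z̃_{m+2})_m`, `ℚ_m = ℚ(ζ_{2^{m+2}})⁺` the `m`-th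
layer of `κ`; by the projection formula `⟨Cor y, Q⟩_{ℚ_{m,v}} = ⟨y, Q⟩_{ℚ₂(ζ_{2^{m+2}})}` the layer pairing sees the full trace
`Σ_{b ∈ (ℤ/2^{m+2})ˣ} τ_b` — the level-to-layer passage of `IwasawaCohomologyZetaLiftTwo.levelToLayerTwo` in the `T₂E` twin.
(R3) THE DUAL EXPONENTIAL THROUGH `Θ`. `Θ` identifies `T_ρ|_{G_v} ≅ T₂W^n`; Bloch–Kato's `exp`/`exp*` are natural in the
representation, so `exp*_{V_ρ} = Θ^*(exp*_{V₂W})^{⊕n}` up to the `G_v`-automorphism relating `ePk` to the Weil pairings, and on `W`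
Rubin §5 (2)/Kobayashi (8.29)/BK 3.11 read `exp*` against formal points: `⟨x, Q⟩ = Tr(log_ω Q · exp*_ω x)`. The unknown
`K`-linear identification `S(g) ⊗_F F_λ ⊗ K = Fil⁰D_dR(V_ρ) ⊗ K → (K ω_W)^n` is ONE `ℚ₂`-rational map for all layers, i.e. `n`
functionals `ℓ_i` on `F_λ` (extended to `ℚ̄₂`; existentially bound), jointly injective on `𝒪` because `Fil⁰D_dR(V_ρ)` is free of rank
one over `F_λ = F_λ ⊗_{ℚ₂} ℚ₂` of `ℚ₂`-dimension `n` (clause (ND)); `𝒪`-multiples stay OUTSIDE the Galois sums (`ℓ_i(a·ι f)`),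
so no joint embedding of `K_g` and `ℚ(ζ_{2^∞})` is presupposed. The formal logarithm is that of the minimal equation `W ⊗ ℚ₂`
at Mathlib's parameter `z = −x/y` on points with `|x| > 1` (Silverman IV.5–6, VII.2.2), verbatim the `T₂E` twin.
(R4) VALUE LAW IN EVERY REALISATION. Writing `exp*(z̃_N) = ω_g ⊗ y_N`, `per_g(ω_g)⁺ = Ω_+γ⁺` (`γ ∈ V_F(g)`, `γ⁺ ≠ 0`), Kato's
sentence for the even character `χ̄` of `G_N` (conductor `2^N ≥ 4`, so `L_{{2}} = L`) reads `Σ_b χ̄(b)σ_b(y_N) · Ω_+ = L(g, χ̄, 1)`;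
Birch's formula gives `Σ_a χ(a)[a/2^N]⁺_{g,Ω} · Ω = τ(χ) L(g, χ̄, 1)` (even `χ`: plus symbols); hence
`(Σ_b χ̄(b)σ_b y_N) τ(χ) = r Σ_a χ(a)[a/2^N]⁺_{g,Ω}` in `ℂ` with `r = Ω/Ω_+` (times the `2^s` of (R2) for `z̃`), and `r ∈ K_g`
because `Ω_+` is itself a Shimura
period (modular symbols are the (7.13)-pairings of `F`-rational Betti classes with `per_g(ω_g)`; `r := 1` if all plus symbols
vanish). For `χ = 1`: `L_{{2}}(g, 1) = (1 − a₂/2 + ε_M(2)/2) L(g, 1)` and `L(g,1) = {∞,0}_g = Ω[0]⁺_{g,Ω}` — clause (TRIV).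
These are identities between the images of elements of `K_g ⊗_ℚ ℚ(ζ_{2^N})` under `incl ⊗ ι_ℂ` (`ι_ℂ(ζc_N) = e^{2πi/2^N}`,
Kato's `ζ_{pⁿ}`; the witnesses `u_{N,k}` are Kato's values transported along these identifications, compatible in `N`);
`1 ⊗ σ_c` carries the `χ`-identity to the `χ^c`-identity and `Gal(ℚ(ζ_{2^N})/ℚ)` permutes the factor fields of
`K_g ⊗_ℚ ℚ(ζ_{2^N})` transitively, so the identities hold in `K_g ⊗ ℚ(ζ_{2^N})` itself, hence under every pair of ring maps
`(s₁, s₂)` into a field `R` (an `R`-valued character of `(ℤ/2^N)ˣ` factors through `s₂` on the `2^N`-th roots of unity).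
(R5) `p = 2`, CM. Thm. 12.5 is stated for every newform `f` (p. 221) and every prime; §15.16 writes the CM proof out for
`K ⊄ ℚ(ζ_{p^∞})` and reduces (1)(2) to "the same arguments in 13.9–13.13" given Thm. 12.4, which 15.15 proves in both CM cases.
The consumer's `g` is CM with `M` odd, whence `K ∉ {ℚ(i), ℚ(√−2)}`, i.e. `K ⊄ ℚ(ζ_{2^∞})` — the case written out.

## What is NOT asserted (do not let the docstring suggest otherwise)

Not the uniqueness / `F_λ`-linearity of `γ ↦ z_γ^{(p)}` (one class is produced, for one `γ` with `γ⁺ ≠ 0`), not the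
relation `z_{ι(γ)} = −σ_{−1} z_γ`, not the odd characters / `γ⁻` / `Ω⁻` (invisible on the `ℤ₂`-extension: `(1 + σ_{−1})z_γ =
2 z_{γ⁺}` after the twist), not 12.5 (2)–(4), 12.6 (the index of the integral classes), not imprimitive non-trivial characters,
not points outside the formal group, not levels with tame conductor, not any integrality of `ℓ_i`, `y_N`, `r` (the
consumer's `c′ ∈ 𝒪ⁿ`, `w`, `q` absorb `2`-power scalings: `2^sℓ_i = t₀(c′_i ·)` by `hbO`), no `Λ`-adic multiplier (the
consumer's `μt` may be taken constant). NON-VACUITY: `z = 0` forces, through (BK) and (VAL) with `r ≠ 0`, `Σ_a χ(a)[a/2^N]⁺ = 0`,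
i.e. `L(g, χ̄, 1) = 0`, for every even primitive `χ` of `2`-power conductor — false by Rohrlich's non-vanishing theorem
[Rohrlich1984]; so the existential is not met by junk witnesses, exactly as `κ_K ≠ 0` guards the `T₂E` twin.
SPECIAL CASE of print: `p = 2`, weight `2`, `Γ₀(M)`, `r = 1`, pure `2`-power levels, formal points, `W` globally minimal.
-- TODO(general form): every prime `p` (layers `ℚ(ζ_{p^{m+1}})⁺`-indexing for odd `p`), weight `k ≥ 2` with `1 ≤ r ≤ k − 1`,
-- level `Γ₁(N)` with character, the full `F_λ`-linear map `γ ↦ z_γ` with both parities, all points of `E(ℚ_{m,v})`, and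
-- `exp*` as the tree's `B_dR`-side map once `PAdicHodge/DualExpElliptic.expStarCoord` is identified with the layer pairings.

## References

* K. Kato, *p-adic Hodge theory and values of zeta functions of modular forms*, Astérisque 295 (2004) 117–290: Prop. 5.3,
  (5.7.1) (pp. 155, 157); §6.2, §6.5, Thm. 6.6 (pp. 161–163); (7.13) (pp. 168–169); Thm. 9.7 (p. 189); §12.3, Thm. 12.4,
  Thm. 12.5 (pp. 221–222); Rem. 12.8 ff. (p. 223); §13.8 (p. 228); §13.9–13.12 (pp. 229–232); §14.10 (pp. 240–241);
  §15.15–15.16 (p. 265). [Kato2004Asterisque]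
* S. Bloch, K. Kato, *L-functions and Tamagawa numbers of motives* (1990), Def. 3.10, Ex. 3.10.1, Ex. 3.11. [BlochKato1990]
* K. Kato, LNM 1553 (1993), Ch. II Thm. 1.4.1. [Kato1993LNM1553]
* K. Rubin, *Euler systems and modular elliptic curves*, LMS LN 254 (1998), §5 (1)–(2), Thm. 7.1. [Rubin1998Durham]
* S. Kobayashi, Invent. math. 152 (2003), (8.23), (8.28)–(8.29), Prop. 8.25. [Kobayashi2003]
* B. Perrin-Riou, Invent. math. 115 (1994), §3.6.1 (the layer pairings). [PerrinRiou1994Invent]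
* B. J. Birch (1971); B. Mazur, J. Tate, J. Teitelbaum, Invent. Math. 84 (1986), §I.8 (8.6); Ju. I. Manin, Izv. 6 (1972),
  Thm. 1.3. [Birch1971] [MazurTateTeitelbaum1986Invent] [Manin1972]
* R. Pollack, T. Weston, Duke Math. J. 156 (2011), §2.2; G. Shimura, Comm. Pure Appl. Math. 29 (1977), Thm. 1.
  [PollackWeston2011MT] [Shimura1977]
* D. Rohrlich, Invent. Math. 75 (1984) (non-vanishing of cyclotomic twists; non-vacuity remark only). [Rohrlich1984]
* J. H. Silverman, AEC (2009), IV.5–IV.6, VII.2.2. [SilvermanAEC2009]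
* A. Burungale, Y. Tian, Ann. of Math. 203 (2026), Thm. 2.4 / Rem. 2.5 (= [Kato, Thm. 12.5], restated for "`f ∈ S_k(Γ₁(N))` an
  elliptic newform and `p` a prime"). [BurungaleTian2026]
* Tree: `Kato2004/IwasawaCohomologyCoeff{,Newform}.lean` (the pin `I`, READING (R1)), `Kato2004/EulerSystemTatePairingValuesTwo.lean`
  (the `T₂E` twin and its frames), `Kato2004/EulerSystemValues.lean` (`sigma`; the printed-statement transcriptions),
  `CyclotomicLayerRhoTatePairingPk.lean` (`rhoLayerPairingPk`), `GreenbergSelmerCofreeReductionPk.lean` (`divPowCofreeMkTorsion`),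
  `MazurTateElementCoeffField.lean` (`IsPlusPeriod`, `plusSymbolK`), `ModularSymbols.lean` (`twisted_LValue_eq`,
  `modularSymbol_zero_eq`), `Summits/…/Theorems/ResidualThetaTransportAtTwo{Defs,KatoZetaDefs}.lean` (the consumer's pins and
  clauses (BKρ)/(VALρ)/(TRIVρ), served here binder for binder: `pair ↦ π.pair`, `t₀, bO, bO', ζ, ePk ↦ π.…`, `Θ ↦ Θ π.v π.hv`,
  frame `↦ F.Φ, F.φ, F.τ` with `e_k` built from `PadicCyclotomicTower.zeta`, `s₁ ↦ ι`, `s₂ ↦ e_N`, `R ↦ ℚ̄₂`).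
-/

noncomputable section

open scoped Classical NumberField
open Field IsDedekindDomain CongruenceSubgroup NumberField WeierstrassCurve
open Literature.NumberTheory.GaloisRepresentations
open Literature.NumberTheory.EllipticCurves Literature.NumberTheory.EllipticCurves.ModularForms
open Literature.NumberTheory.EllipticCurves.Kobayashi2003 Literature.NumberTheory.EllipticCurves.GreenbergSelmer
open Literature.NumberTheory.EllipticCurves.Kato2004.EulerSystemValues
open ZpExtension

namespace Literature.NumberTheory.EllipticCurves.Kato2004

/-- **Kato 2004, Thm. 12.5 (1) — the `2`-adic zeta element of a weight-`2` newform `g ∈ S₂(Γ₀(M))` with `𝒪_λ`-coefficients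
and its dual-exponential values, read on the pinned layer Tate pairings of `T_ρ` through a local transport `Θ` (Bloch–Kato 1990
§3, Rubin 1998 §5 (2), Kobayashi 2003 (8.29)) and, for the value law, in every realisation of `K_g ⊗ ℚ(ζ_{2^N})` (Kato 12.5 (1)
∘ Birch's formula).**  For every newform `g` (`IsNewform0`), `ι : K_g → ℚ̄₂`, Shimura period `Ω`, integral model `ρ` of `g`
along `ι` (arithmetic Frobenius polynomials `X² − ι(a_ℓ)X + ℓ`, `ℓ ∤ 2M`: a stable `O_λ`-lattice of `V_{F_λ}(g)(1)`, READING
(R1)), cyclotomic `κ` with generator `γ`, datum `I : IwasawaH1DataCoeff ρ 2 κ γ`, globally minimal `W/ℚ`, place `v ∋ 2`,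
transport `Θ : A_ρ ≃+ E[2^∞]ⁿ` equivariant at `v`, Frobenius datum `(t₀, bO, bO')`, roots of unity `ζ_k`, self-dual tower `ePk`
pinned by `t₀, ζ`, `ℤ₂`-valued layer pairing family `pair` with residues `rhoLayerPairingPk` (hypothesis by name), and `2`-adic
frame `(Φ, φ, ζc, e, τ)` (`e` coherent along `ζc_k ↦ ζc_{k+1}²`), THERE EXIST a class `z ∈ I.H` (Kato's `z_γ^{(p)}`, `γ⁺ ≠ 0`,
made integral and corestricted to the layers — (R2)), functionals `ℓ_i` separating `𝒪` ((R3), clause (ND)), RATIONAL values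
`y_N = Σ_k f_{N,k} ⊗ u_{N,k} ∈ K_g ⊗ ℚ(ζ_{2^N})` ("belongs to `S(f) ⊗_ℚ ℚ(ζ_{pⁿ})`") and `r ∈ K_g^×` (`= 2^sΩ/Ω_+`, (R2), (R4))
with:
(BK) `⟨proj_m(a·z), Q₀e_i⟩_m = Σ_k ℓ_i(a·ιf_{m+2,k}) Σ_{b∈(ℤ/2^{m+2})ˣ} τ_{m+2}(b)(log_W(z(Q₀)) · e_{m+2}(u_{m+2,k}))` for every
`a ∈ 𝒪`, layer `m`, coordinate `i`, formal point `Q₀` ["`(x, z)_n = Tr log_Ê(x) exp*_{ω_E}(z)`", Kobayashi (8.29); Rubin (2)];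
(VAL) for `N ≥ 2`, every field `R` with ring maps `s₁ : K_g → R`, `s₂ : ℚ(ζ_{2^N}) → R`, every even primitive `χ mod 2^N`:
`(Σ_k s₁f_{N,k} Σ_b χ⁻¹(b) s₂(σ_b u_{N,k})) · τ_{s₂}(χ) = s₁(r) Σ_a χ(a) s₁[a/2^N]⁺_{g,Ω}` ["`Σ_{σ∈G_n} χ(σ)σ(y) per_f(x)^±` …
`= (2πi)^{k−r−1} L_{{p}}(f*, χ, r) γ^±`" with `k = 2`, `r = 1`, `χ ↦ χ̄`, times `τ(χ)`, Birch's formula];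
(TRIV) for `N ≥ 2` and every `(R, s₁, s₂)`: `2 Σ_k s₁f_{N,k} Σ_b s₂(σ_b u_{N,k}) = s₁(r)(2 − s₁a₂(g) + ε_M(2)) s₁[0]⁺_{g,Ω}`
[`χ = 1`: `L_{{2}}(g,1) = (1 − a₂/2 + ε_M(2)/2) L(g,1)`, `L(g,1) = {∞,0}_g`].  Special case of print (`p = 2`, weight `2`, `r = 1`,
`2`-power levels, even characters, formal points); readings (R1)–(R5) of the module docstring; named fact, nothing asserted,
no `_holds` expected.
[cite: Kato2004Asterisque, Thm. 12.5 (1) (pp. 221–222); Thm. 12.4 (2) (p. 221); §13.9–13.12 (pp. 229–232); §15.16 (p. 265); §6.2 (p. 161); §14.10 (pp. 240–241)]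
[cite: BlochKato1990, Def. 3.10 and Ex. 3.10.1 (pp. 359–360), Ex. 3.11 (p. 361)]
[cite: Rubin1998Durham, §5 displays (1)–(2) and Thm. 7.1]
[cite: Kobayashi2003, (8.23) (p. 18), (8.28)–(8.29) and Prop. 8.25 (p. 24)]
[cite: MazurTateTeitelbaum1986Invent, §I.8 (8.6)] [cite: PollackWeston2011MT, §2.2] [cite: SilvermanAEC2009, IV.5–IV.6 and Prop. VII.2.2] -/
def exists_zetaElement_newform_tatePairing_values_two : Prop :=
  ∀ (M : ℕ) [NeZero M] (g : CuspForm (Gamma0 M) 2) (ι : coeffField g →+* PadicAlgCl 2) (Ω : ℂ)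
    (ρ : FramedGaloisRep ℚ (padicCoeffIntegers (Set.range ι)) 2)
    (κ : ZpExtension ℚ 2) (γ : absoluteGaloisGroup ℚ),
    IsNewform0 g → IsPlusPeriod g Ω →
    (∀ v : HeightOneSpectrum (𝓞 ℚ), ¬ Rat.HeightOneSpectrum.natGenerator v ∣ 2 * M →
      ρ.IsUnramifiedAt v ∧
        ∃ P : Polynomial (padicCoeffIntegers (Set.range ι)),
          P.map (padicCoeffIntegers (Set.range ι)).subtype =
              Polynomial.X ^ 2
                - Polynomial.C (embCoeff g ι (Rat.HeightOneSpectrum.natGenerator v)) * Polynomial.X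
                + Polynomial.C ((Rat.HeightOneSpectrum.natGenerator v : ℕ) : PadicAlgCl 2) ∧
            ρ.HasFrobCharpolyAt v P) →
    κ.IsCyclotomic → κ.IsTopGenerator γ →
  ∀ (I : IwasawaH1DataCoeff ρ.toGaloisRep 2 κ γ)
    -- the auxiliary elliptic curve, the place above `2`, and the local transport `Θ : A_ρ ≃ E[2^∞]ⁿ` at `v`
    (W : WeierstrassCurve ℚ) [W.IsElliptic] [W.IsGloballyMinimal] (n : ℕ)
    (v : HeightOneSpectrum (𝓞 ℚ)) (hv : ((2 : ℕ) : 𝓞 ℚ) ∈ v.asIdeal)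
    (Θ : Cofree ρ ↥(padicCoeffField (Set.range ι)) ≃+ (Fin n → ↥(W.geomPrimaryTorsion 2)))
    (hΘ : ∀ (δ : absoluteGaloisGroup (v.adicCompletion ℚ)) (m : Cofree ρ ↥(padicCoeffField (Set.range ι))) (i : Fin n),
      Θ (resGalOfEmb (closureEmb (K := ℚ) (v.adicCompletion ℚ)) δ • m) i =
        resGalOfEmb (closureEmb (K := ℚ) (v.adicCompletion ℚ)) δ • Θ m i)
    -- Frobenius datum `t₀` of `𝒪/ℤ₂` with dual families (the pins `t₀`, `bO`, `bO'`; they make `t₀` non-degenerate)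
    (t₀ : ↥(padicCoeffIntegers (Set.range ι)) →+ ℤ_[2])
    (ht₀ : ∀ (c : ℤ_[2]) (a : ↥(padicCoeffIntegers (Set.range ι))), t₀ (padicIntToCoeffIntegers (Set.range ι) c * a) = c * t₀ a)
    (nb : ℕ) (bO bO' : Fin nb → ↥(padicCoeffIntegers (Set.range ι)))
    (hbO : ∀ a : ↥(padicCoeffIntegers (Set.range ι)), a = ∑ i, padicIntToCoeffIntegers (Set.range ι) (t₀ (a * bO' i)) * bO i)
    -- the self-dual tower `e_k : A_ρ[2^k] × A_ρ[2^k] → μ_{2^k}` pinned by `t₀` and a choice `ζ` of roots of unity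
    (ζ : ℕ → AlgebraicClosure ℚ) (hζ : ∀ k, IsPrimitiveRoot (ζ k) (2 ^ k))
    (ePk : ∀ k : ℕ, ↥(AddSubgroup.torsionBy (Cofree ρ ↥(padicCoeffField (Set.range ι))) ((2 ^ k : ℕ) : ℤ)) →
      ↥(AddSubgroup.torsionBy (Cofree ρ ↥(padicCoeffField (Set.range ι))) ((2 ^ k : ℕ) : ℤ)) → AlgebraicClosure ℚ)
    (hμPk : ∀ k a b, ePk k a b ^ (2 ^ k) = 1)
    (hadd₁Pk : ∀ k a₁ a₂ b, ePk k (a₁ + a₂) b = ePk k a₁ b * ePk k a₂ b)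
    (hadd₂Pk : ∀ k a b₁ b₂, ePk k a (b₁ + b₂) = ePk k a b₁ * ePk k a b₂)
    (hgalPk : ∀ k (σ : absoluteGaloisGroup ℚ)
      (a b : ↥(AddSubgroup.torsionBy (Cofree ρ ↥(padicCoeffField (Set.range ι))) ((2 ^ k : ℕ) : ℤ))),
      σ • ePk k a b = ePk k (cofreeTorsionGaloisModule (Set.range ι) ρ _ σ a) (cofreeTorsionGaloisModule (Set.range ι) ρ _ σ b))
    (hePk : ∀ k (s t : Fin 2 → ↥(padicCoeffIntegers (Set.range ι))),
      ePk k (divPowCofreeMkTorsion (Set.range ι) ρ k s) (divPowCofreeMkTorsion (Set.range ι) ρ k t) =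
        ζ k ^ (PadicInt.toZModPow k (t₀ (s 0 * t 1 - s 1 * t 0))).val)
    -- THE `ℤ₂`-valued layer Tate pairing family, pinned by its residues (hypothesis by name)
    (pair : ∀ m : ℕ, H1 (FramedGaloisRep.toGaloisRep ρ) (κ.layerSubgroup m) →+
      ((Fin n → ↥(localLayerPointsOfEmb κ (closureEmb (K := ℚ) (v.adicCompletion ℚ)) W m)) →+ ℤ_[2])),
    (∀ (m k : ℕ) (x : H1 (FramedGaloisRep.toGaloisRep ρ) (κ.layerSubgroup m))
      (Q : Fin n → ↥(localLayerPointsOfEmb κ (closureEmb (K := ℚ) (v.adicCompletion ℚ)) W m)),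
      PadicInt.toZModPow k (pair m x Q) =
        CyclotomicLayer.rhoLayerPairingPk (Set.range ι) ρ W ePk hμPk hadd₁Pk hadd₂Pk hgalPk Θ κ v hΘ m k x Q) →
  -- the `2`-adic frame: `Φ : ℚ̄₂ ≅ ℚ̄_v` over `φ : ℚ₂ ≅ ℚ_v`, primitive roots `ζc_k`, a tower `e_k : ℚ(ζ_{2^k}) → ℚ̄₂` COHERENT
  -- along `ζc_k ↦ ζc_{k+1}²`, and Galois lifts `τ_k(a)` acting on `e_k(ζc_k)` by `a`-th powers
  ∀ (Φ : AlgebraicClosure ℚ_[2] ≃ₐ[ℚ] AlgebraicClosure (v.adicCompletion ℚ)) (φ : ℚ_[2] ≃+* v.adicCompletion ℚ),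
    (∀ y : ℚ_[2], Φ (algebraMap ℚ_[2] (AlgebraicClosure ℚ_[2]) y) =
      algebraMap (v.adicCompletion ℚ) (AlgebraicClosure (v.adicCompletion ℚ)) (φ y)) →
  ∀ (ζc : ∀ k : ℕ, CyclotomicField (2 ^ k) ℚ) (hζc : ∀ k : ℕ, IsPrimitiveRoot (ζc k) (2 ^ k))
    (e : ∀ k : ℕ, CyclotomicField (2 ^ k) ℚ →ₐ[ℚ] PadicAlgCl 2)
    (τ : ∀ k : ℕ, ZMod (2 ^ k) → Field.absoluteGaloisGroup ℚ_[2]),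
    (∀ k : ℕ, e (k + 1) (ζc (k + 1)) ^ 2 = e k (ζc k)) →
    (∀ (k : ℕ) (a : ZMod (2 ^ k)), IsUnit a → τ k a • e k (ζc k) = e k (ζc k) ^ a.val) →
  -- CONCLUSION: Kato's class, the comparison functionals, the RATIONAL values, the period ratio
  ∃ (z : I.H) (ℓ : Fin n → (PadicAlgCl 2 →ₗ[ℚ_[2]] ℚ_[2])) (L : ℕ → ℕ)
    (f : ∀ N : ℕ, Fin (L N) → coeffField g) (u : ∀ N : ℕ, Fin (L N) → CyclotomicField (2 ^ N) ℚ)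
    (r : coeffField g),
    r ≠ 0 ∧
    -- (ND) the comparison functionals separate `𝒪`
    Function.Injective (fun (a : ↥(padicCoeffIntegers (Set.range ι))) (i : Fin n) => ℓ i (a : PadicAlgCl 2)) ∧
    -- (BK) the layer pairing of `proj_m (a • z)` against a formal point in coordinate `i` = trace of `log_W(Q₀) · (value)`
    (∀ (a : ↥(padicCoeffIntegers (Set.range ι))) (m : ℕ) (i : Fin n) (Q₀ : localPoints W ℚ_[2])
      (hQv : WeierstrassCurve.Affine.Point.map (W' := W)
          (Φ : AlgebraicClosure ℚ_[2] →ₐ[ℚ] AlgebraicClosure (v.adicCompletion ℚ))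
          (show (W.baseChange (AlgebraicClosure ℚ_[2])).toAffine.Point from Q₀) ∈
        localLayerPointsOfEmb κ (closureEmb (K := ℚ) (v.adicCompletion ℚ)) W m),
      (∀ (X Y : AlgebraicClosure ℚ_[2]) (hXY : (W.baseChange (AlgebraicClosure ℚ_[2])).toAffine.Nonsingular X Y),
          (show (W.baseChange (AlgebraicClosure ℚ_[2])).toAffine.Point from Q₀) = .some X Y hXY → 1 < Valued.v X) →
      algebraMap ℚ_[2] (PadicAlgCl 2)
          ((pair m (I.proj m ((PowerSeries.C (a : ↥(padicCoeffIntegers (Set.range ι))) :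
              IwasawaAlgebraO (Set.range ι)) • z)) (Pi.single i ⟨_, hQv⟩) : ℤ_[2]) : ℚ_[2]) =
        ∑ k : Fin (L (m + 2)), algebraMap ℚ_[2] (PadicAlgCl 2) (ℓ i ((a : PadicAlgCl 2) * ι (f (m + 2) k))) *
          ∑ b : (ZMod (2 ^ (m + 2)))ˣ, τ (m + 2) (b : ZMod (2 ^ (m + 2))) •
            ((∑' j : ℕ, algebraMap ℚ_[2] (PadicAlgCl 2) (PowerSeries.coeff j (W.map (algebraMap ℚ ℚ_[2])).formalLog) *
                (WeierstrassCurve.Affine.Point.zCoord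
                  (show (W.baseChange (AlgebraicClosure ℚ_[2])).toAffine.Point from Q₀)) ^ j) *
              e (m + 2) (u (m + 2) k))) ∧
    -- (VAL) the value law at the EVEN PRIMITIVE characters of conductor `2^N`, `N ≥ 2`, in every realisation `(R, s₁, s₂)`
    (∀ (N : ℕ), 2 ≤ N → ∀ (R : Type) [Field R] (s₁ : coeffField g →+* R) (s₂ : CyclotomicField (2 ^ N) ℚ →+* R)
      (χ : DirichletCharacter R (2 ^ N)), χ (-1) = 1 → χ.IsPrimitive →
      (∑ k : Fin (L N), s₁ (f N k) *
          ∑ b : (ZMod (2 ^ N))ˣ, χ⁻¹ (b : ZMod (2 ^ N)) * s₂ (sigma (2 ^ N) b (u N k))) *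
        gaussSum χ (AddChar.zmodChar (2 ^ N) ((hζc N).map_of_injective s₂.injective).pow_eq_one) =
      s₁ r * ∑ a : ZMod (2 ^ N), χ a * s₁ (plusSymbolK g Ω ((a.val : ℚ) / (2 : ℚ) ^ N))) ∧
    -- (TRIV) the value at the trivial character of every level `2^N`, `N ≥ 2`: the `2`-depleted central value
    (∀ (N : ℕ), 2 ≤ N → ∀ (R : Type) [Field R] (s₁ : coeffField g →+* R) (s₂ : CyclotomicField (2 ^ N) ℚ →+* R),
      2 * ∑ k : Fin (L N), s₁ (f N k) * ∑ b : (ZMod (2 ^ N))ˣ, s₂ (sigma (2 ^ N) b (u N k)) =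
        s₁ r * (2 - s₁ ⟨cuspCoeff g 2, coeff_mem_coeffField g 2⟩ + (if 2 ∣ M then 0 else 1)) *
          s₁ (plusSymbolK g Ω 0))

end Literature.NumberTheory.EllipticCurves.Kato2004

end
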